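import Summits.BirchSwinnertonDyer.BirchSwinnertonDyer.Theorems.GenusKolyvaginAtTwoMinimalTwinBSDTwoTwinHalvingDescent
import Summits.BirchSwinnertonDyer.BirchSwinnertonDyer.Theorems.GenusKolyvaginAtTwoShaCellLowerHalfTransposition
import HarnessLib

/-!
# Route `GenusKolyvaginAtTwo` — THE HALVING DESCENT FOR EVERY ANALYTIC-RANK-ONE HABITAT MEMBER (Ш-cell 27477 / LINE 42 included): a `2^M`-Selmer
# class of the twin of order `2^{M₀}` gives `4^{M₀} ∣ #Ш(W_K)[2^∞]`, either sign of `Δ`, NO Selmer hypothesis on `W`, modulo Q2 + GZK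

Seat `bsd-line-gk2-p2` g32 (PROVER seat 2/3, cell `bsd-f1-sign2`, LINE 23 holder), `--supports stmt-BirchSwinnertonDyer-22985 --as helper`
(serves stmt-BirchSwinnertonDyer-27477 by shape).  THEOREMS ONLY (no definition, no named fact, no `sorry`).  BSD is NOT proved by any of this;
neither U₂ nor the Ш-cell; nothing is closed.

WHAT.  This seat's B2Q♭⁻± (`exists_transpositionWitness_of_two_pow_pred_smul_selmer_twist_ne_zero_signFree`, p813942) carries NO `#Sel₂(W)` hypothesis:
it needs the habitat, `w(W) = −1`, the exact depth `M₀` of `P(1)` (`2^{M₀+1} ∤ P(1)`) and a class `s₀ ∈ Sel_(2^M)(W^{(d_K)}/ℚ)` with `2^{M₀−1} • s₀ ≠ 0`.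
So for EVERY analytic-rank-one habitat member — in particular on the Ш-cell (`W(ℚ)[2] = 0`, `#Sel₂(W) ≠ 2`) — such a twin class PRODUCES the transposition-
deep prime witness, and p813519 §2 (`pow_dvd_natCard_sha_baseChange_of_transpositionWitness_of_analyticRank_one`, rank input from GZK) turns it into the
lower half.  LINE 42's STRUCT₂′/U1♯′ at frames where «the twin's `2^∞`-Selmer group is as deep as `y_K`» therefore needs no Kolyvagin-conjecture input.
* §1 `exists_transpositionWitness_of_selmer_twist_class_of_analyticRank_one` — the witness clause (K4Pos shape) for an `r_an = 1` habitat member from a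
  twin class of order `≥ 2^{M₀}` (`M₀ ≥ 1`), mod Q2.
* §2 `pow_dvd_natCard_sha_baseChange_of_selmer_twist_class_of_analyticRank_one` — **`4^{M₀} ∣ #Ш(W_K)[2^∞]`** there, mod Q2 + GZK.

HONEST FRAMING.  CONDITIONAL (Q2 = item 24880; GZK = `rank_eq_analyticRank_of_analyticRank_le_one`); the existence of the deep twin class is the
open input; nothing beyond print is claimed; BSD is NOT proved.

References: [Kolyvagin1989Izv] Thm. B_l, §3; [McCallumLMS1991] §5 Lemma 5.3, Thm. 5.4; [Kolyvagin1991MathAnn] Thm. 2.1–2.2; [Darmon2004] Thm. 3.22.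
-/

set_option autoImplicit false
set_option linter.dupNamespace false -- `Summit.<P>.<Sub>` repeats `BirchSwinnertonDyer` (D-0017)

noncomputable section

open scoped Classical

namespace Summit.BirchSwinnertonDyer.BirchSwinnertonDyer.Theorems.GenusExact.TwinSwap.TwinAnnihilation

open Literature.NumberTheory.EllipticCurves Literature.NumberTheory.GaloisRepresentations WeierstrassCurve NumberField
  IsDedekindDomain Field AddSubgroup Literature.NumberTheory.EllipticCurves.ModularForms
open Summit.BirchSwinnertonDyer.Rank1Residual
open Summit.BirchSwinnertonDyer.BirchSwinnertonDyer.Theses.GenusKolyvaginAtTwo (KolyvaginRelationAtTwo)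

/-! ## §1 The witness clause for an analytic-rank-one habitat member from a deep twin class -/

/-- **A `2^M`-Selmer class of the twin of order `≥ 2^{M₀}` (`M ≥ M₀+1`, `M₀ ≥ 1`) gives the transposition-deep witness clause for EVERY analytic-rank-one
habitat member**, either sign of `Δ`, modulo Q2 — B2Q♭⁻± repackaged (`w(W) = −1` from `r_an(W) = 1`; the Theorem-B exclusions are automatic); NO `#Sel₂(W)`
hypothesis.  CONDITIONAL on Q2; BSD is NOT proved. [cite: Kolyvagin1989Izv, Thm. B_l, §3] [cite: McCallumLMS1991, §5 Lemma 5.3, Thm. 5.4] -/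
theorem exists_transpositionWitness_of_selmer_twist_class_of_analyticRank_one (hQ2 : KolyvaginRelationAtTwo)
    (W : WeierstrassCurve ℚ) [W.IsElliptic] [W.IsGloballyMinimal] [NeZero (W.conductorNorm ℤ)] (hcm : ¬ W.HasCM) (hr : W.analyticRank = 1)
    (hT : Odd W.tamagawaProduct) (v : HeightOneSpectrum (𝓞 ℚ)) (h2v : ((2 : ℕ) : 𝓞 ℚ) ∉ v.asIdeal)
    (hNv : ((W.conductorNorm ℤ : ℕ) : 𝓞 ℚ) ∈ v.asIdeal) (hmult : W.HasMultiplicativeReductionAt v)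
    (K : Type) [Field K] [NumberField K] (hIQ : IsImaginaryQuadratic K) (hodd : Odd (NumberField.discr K))
    (h3 : NumberField.discr K ≠ -3) (hHe : SatisfiesHeegnerHypothesis (W.conductorNorm ℤ) K)
    (hρ : ∀ n : ℕ, 0 < n → W.HasSurjectiveModNGaloisRep ((2 : ℤ) ^ n))
    (Dt : ModularParametrizationData W (W.conductorNorm ℤ)) (β : ℤ) (ι : K →+* ℂ) (d₁ : KolyvaginHeegnerData Dt β ι 1) (M₀ : ℕ)
    (hndiv : ¬ ∃ Q : (W.baseChange (ringClassField K ι 1)).toAffine.Point, ((2 ^ (M₀ + 1) : ℕ) : ℤ) • Q = d₁.derivedPoint)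
    [(W.quadraticTwist ((NumberField.discr K : ℤ) : ℚ)).IsElliptic]
    (M : ℕ) (hM₀M : M₀ + 1 ≤ M) (s₀ : galH1Torsion (W.quadraticTwist ((NumberField.discr K : ℤ) : ℚ)) ((2 ^ M : ℕ) : ℤ))
    (hs₀ : s₀ ∈ selmerGroup (W.quadraticTwist ((NumberField.discr K : ℤ) : ℚ)) ((2 ^ M : ℕ) : ℤ))
    (hne : ((2 ^ (M₀ - 1) : ℕ) : ℤ) • s₀ ≠ 0) :
    ∃ (n : ℕ) (d : KolyvaginHeegnerData Dt β ι n), Squarefree n ∧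
      (∀ ℓ ∈ n.primeFactors, Zhang2014.IsKolyvaginPrime (W.conductorNorm ℤ) W K 2 ℓ ∧ 2 ≤ Zhang2014.kolyvaginIndex W 2 ℓ ∧
        ∃ (v : HeightOneSpectrum (𝓞 ℚ)) (𝔓 : Ideal (absIntegers (𝓞 ℚ) ℚ)) (h : absoluteGaloisGroup ℚ),
          ((ℓ : ℕ) : 𝓞 ℚ) ∈ v.asIdeal ∧ 𝔓 ∈ v.primesAbove ∧ IsArithFrobAt (𝓞 ℚ) h 𝔓 ∧ ∃ u : W.geomTorsion ((2 : ℕ) : ℤ), h • u ≠ u) ∧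
      ¬ ∃ Q : (W.baseChange (ringClassField K ι n)).toAffine.Point, (2 : ℤ) • Q = d.derivedPoint := by
  obtain ⟨hsq1, hsq2⟩ := kolyvaginExclusions_of_odd_of_satisfiesHeegnerHypothesis W hIQ hodd hHe
  have hw : W.rootNumber = -1 := TwinSwapBit.rootNumber_eq_neg_one_of_analyticRank_eq_one W hr Dt
  obtain ⟨ℓ, d, hkol, hidx, ⟨v', 𝔓, h, c₀, hℓv', h𝔓, hfr, -, -, hu, -⟩, -, -, hPn⟩ :=
    exists_transpositionWitness_of_two_pow_pred_smul_selmer_twist_ne_zero_signFree hQ2 W hcm hT v h2v hNv hmult K hIQ hodd h3 hHe hsq1 hsq2 hρ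
      Dt β ι d₁ M₀ hndiv hw M hM₀M s₀ hs₀ hne
  have hℓp : ℓ.Prime := hkol.1
  refine ⟨1 * ℓ, d, by rw [one_mul]; exact hℓp.squarefree, fun q hq ↦ ?_, hPn⟩
  rw [one_mul, hℓp.primeFactors, Finset.mem_singleton] at hq
  subst hq
  exact ⟨hkol, le_trans (by omega) hidx, v', 𝔓, h, hℓv', h𝔓, hfr, hu⟩

/-! ## §2 The lower half for an analytic-rank-one habitat member from a deep twin class -/

/-- **`4^{M₀} ∣ #Ш(W_K)[2^∞]` for EVERY analytic-rank-one habitat member from ONE `2^M`-Selmer class of the twin of order `≥ 2^{M₀}`** (`M ≥ M₀+1`,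
`M₀ ≥ 1`; for `M₀ = 0` the statement is trivial), either sign of `Δ`, NO `#Sel₂(W)` hypothesis, modulo Q2 + GZK: §1 then p813519 §2.  Serves LINE 42's
STRUCT₂′ on the habitat at frames where the twin's Selmer group is as deep as `y_K`.  CONDITIONAL; closes nothing; BSD is NOT proved.
[cite: Kolyvagin1991MathAnn, Thm. 2.1–2.2] [cite: McCallumLMS1991, §5 Thm. 5.4] [cite: Darmon2004, Thm. 3.22] -/
theorem pow_dvd_natCard_sha_baseChange_of_selmer_twist_class_of_analyticRank_one (hQ2 : KolyvaginRelationAtTwo)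
    (hGZK : rank_eq_analyticRank_of_analyticRank_le_one)
    (W : WeierstrassCurve ℚ) [W.IsElliptic] [W.IsGloballyMinimal] [NeZero (W.conductorNorm ℤ)] (hcm : ¬ W.HasCM) (hr : W.analyticRank = 1)
    (hT : Odd W.tamagawaProduct) (v : HeightOneSpectrum (𝓞 ℚ)) (h2v : ((2 : ℕ) : 𝓞 ℚ) ∉ v.asIdeal)
    (hNv : ((W.conductorNorm ℤ : ℕ) : 𝓞 ℚ) ∈ v.asIdeal) (hmult : W.HasMultiplicativeReductionAt v)
    (K : Type) [Field K] [NumberField K] (hIQ : IsImaginaryQuadratic K) (hodd : Odd (NumberField.discr K))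
    (h3 : NumberField.discr K ≠ -3) (hHe : SatisfiesHeegnerHypothesis (W.conductorNorm ℤ) K)
    (hρ : ∀ n : ℕ, 0 < n → W.HasSurjectiveModNGaloisRep ((2 : ℤ) ^ n))
    (Dt : ModularParametrizationData W (W.conductorNorm ℤ)) (β : ℤ) (ι : K →+* ℂ) (d₁ : KolyvaginHeegnerData Dt β ι 1)
    (hy : ¬ IsOfFinAddOrder d₁.derivedPoint) (M₀ : ℕ)
    (hdiv : ∃ Q : (W.baseChange (ringClassField K ι 1)).toAffine.Point, ((2 ^ M₀ : ℕ) : ℤ) • Q = d₁.derivedPoint)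
    (hndiv : ¬ ∃ Q : (W.baseChange (ringClassField K ι 1)).toAffine.Point, ((2 ^ (M₀ + 1) : ℕ) : ℤ) • Q = d₁.derivedPoint)
    [(W.quadraticTwist ((NumberField.discr K : ℤ) : ℚ)).IsElliptic]
    (M : ℕ) (hM₀M : M₀ + 1 ≤ M) (s₀ : galH1Torsion (W.quadraticTwist ((NumberField.discr K : ℤ) : ℚ)) ((2 ^ M : ℕ) : ℤ))
    (hs₀ : s₀ ∈ selmerGroup (W.quadraticTwist ((NumberField.discr K : ℤ) : ℚ)) ((2 ^ M : ℕ) : ℤ))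
    (hne : ((2 ^ (M₀ - 1) : ℕ) : ℤ) • s₀ ≠ 0) :
    2 ^ (2 * M₀) ∣ Nat.card (AddCommGroup.primaryComponent (W.baseChange K).sha 2) := by
  obtain ⟨n, d, hn, hdeep, hPn⟩ := exists_transpositionWitness_of_selmer_twist_class_of_analyticRank_one hQ2 W hcm hr hT v h2v hNv hmult K hIQ
    hodd h3 hHe hρ Dt β ι d₁ M₀ hndiv M hM₀M s₀ hs₀ hne
  exact pow_dvd_natCard_sha_baseChange_of_transpositionWitness_of_analyticRank_one hQ2 hGZK W hcm hr hT v h2v hNv hmult K hIQ hodd h3 hHe hρ Dt β ι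
    d₁ hy M₀ hdiv hndiv n d hn hdeep hPn

end Summit.BirchSwinnertonDyer.BirchSwinnertonDyer.Theorems.GenusExact.TwinSwap.TwinAnnihilation

end
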